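import Mathlib
import Summits.Ventures.PercRepro.TriangleCapDeepRows

/-!
# PercRepro — THE BOTTOM OF THE DEEP SUB-BANDS ON `4 + (s − t)` VERTICES (p3, gen 54; part 281)

With THREE non-neighbours of `w`, every off-degree at most `D ≥ 3`, and `2 D < t` (the DEEP regime `u = t − D >
t/2`), the band value `2 j` satisfies `t ≤ 3 D` and

  **`(D − 1)(2 t − 3 D) ≤ j`**   (`deep_three_lower_bound`)

— the bottom of the deep sub-band `u` is `(t − u − 1)(3 u − t) = B(u) + (D − 1)(2 u − t)`, ABOVE the shallow bottom
`B(u) = u (t − u − 1)`; it is the value of the nested bipartite configuration with left degrees `(D, D, t − 2 D)`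
(its rows: `t − 2 D` full rows and `3 D − t` rows of size two).  THE PROOF is the deficiency identity of part 279
at `|L| = 3` (`deep_three_identity`: the rows cost `(D − 3) attach + 2 |partialNbrs|`, part 280), the spread bound
`nbrDeg x ≤ nbrDeg x' + |partialNbrs|` (`nbrDeg x + nbrDeg x' ≤ |partialNbrs|` across an inside edge), and three
polynomial inequalities — one per shape of the inside graph on the three non-neighbours (empty, one edge, a path;
a triangle is excluded) — in the deficits `d_i = D − c_i` (`deep_three_arith_zero/one/two`).  AT `t = 3 D` the
bottom is rigid: every non-neighbour has off-degree `D`, there is no inside edge, and `j = bottom + |partialNbrs|`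
with `attach = Σ k(y) ≡ 0 (mod 3)`, so exactly one partial row is impossible — **`j ≠ bottom + 1`**
(`deep_three_not_bottom_succ`).  Axioms: standard.
-/

namespace PercRepro

namespace TriangleCap

namespace C047

open Finset

variable {V : Type*} [Fintype V] [DecidableEq V]

/-- The arithmetic of the deep bottom, no inside edge, deficits sorted `d₁ ≤ d₂ ≤ d₃ ≤ d₁ + n`. -/
theorem deep_three_arith_zero (D t c1 c2 c3 d1 d2 d3 n : ℕ) (h1 : c1 + d1 = D) (h2 : c2 + d2 = D)
    (h3 : c3 + d3 = D) (hsum : c1 + c2 + c3 = t) (ht : 2 * D < t) (hD : 3 ≤ D) (h12 : d1 ≤ d2) (h23 : d2 ≤ d3)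
    (hn : d3 ≤ d1 + n) :
    2 * ((D - 1) * (2 * t - 3 * D)) + 2 * (t * (D - 1)) ≤
      t * (t - 1) + c1 * d1 + c2 * d2 + c3 * d3 + (D - 3) * t + 2 * n := by
  have hD1 : 1 ≤ D := by omega
  have h3D : 3 * D ≤ 2 * t := by omega
  have ht1 : 1 ≤ t := by omega
  zify [hD1, h3D, ht1, hD] at *
  have hc1 : (c1 : ℤ) = D - d1 := by linarith
  have hc2 : (c2 : ℤ) = D - d2 := by linarith
  have hc3 : (c3 : ℤ) = D - d3 := by linarith
  have ht' : (t : ℤ) = 3 * D - d1 - d2 - d3 := by linarith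
  rw [hc1, hc2, hc3, ht']
  rcases Nat.eq_zero_or_pos d2 with hd2 | hd2
  · have hd1 : d1 = 0 := by omega
    have hd1' : (d1 : ℤ) = 0 := by exact_mod_cast hd1
    have hd2' : (d2 : ℤ) = 0 := by exact_mod_cast hd2
    rw [hd1', hd2']
    nlinarith
  · have hd2' : (1 : ℤ) ≤ d2 := by exact_mod_cast hd2
    have hd3' : (1 : ℤ) ≤ d3 := by linarith
    nlinarith [mul_nonneg (show (0:ℤ) ≤ d2 by positivity) (show (0:ℤ) ≤ d3 - 1 by linarith),
      mul_nonneg (show (0:ℤ) ≤ d1 by positivity) (show (0:ℤ) ≤ d3 - 1 by linarith),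
      mul_nonneg (show (0:ℤ) ≤ d1 by positivity) (show (0:ℤ) ≤ d2 - 1 by linarith)]

/-- The arithmetic of the deep bottom, no inside edge, with the six spread bounds `cᵢ ≤ cⱼ + n`. -/
theorem deep_three_arith_zero' (D t c1 c2 c3 d1 d2 d3 n : ℕ) (h1 : c1 + d1 = D) (h2 : c2 + d2 = D)
    (h3 : c3 + d3 = D) (hsum : c1 + c2 + c3 = t) (ht : 2 * D < t) (hD : 3 ≤ D)
    (h12 : c1 ≤ c2 + n) (h13 : c1 ≤ c3 + n) (h21 : c2 ≤ c1 + n) (h23 : c2 ≤ c3 + n) (h31 : c3 ≤ c1 + n)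
    (h32 : c3 ≤ c2 + n) :
    2 * ((D - 1) * (2 * t - 3 * D)) + 2 * (t * (D - 1)) ≤
      t * (t - 1) + c1 * d1 + c2 * d2 + c3 * d3 + (D - 3) * t + 2 * n := by
  rcases le_total d1 d2 with a | a <;> rcases le_total d2 d3 with b | b <;> rcases le_total d1 d3 with c | c
  all_goals first
    | exact deep_three_arith_zero D t c1 c2 c3 d1 d2 d3 n h1 h2 h3 hsum ht hD (by omega) (by omega) (by omega)
    | (have := deep_three_arith_zero D t c1 c3 c2 d1 d3 d2 n h1 h3 h2 (by omega) ht hD (by omega) (by omega)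
          (by omega)
       linarith)
    | (have := deep_three_arith_zero D t c2 c1 c3 d2 d1 d3 n h2 h1 h3 (by omega) ht hD (by omega) (by omega)
          (by omega)
       linarith)
    | (have := deep_three_arith_zero D t c2 c3 c1 d2 d3 d1 n h2 h3 h1 (by omega) ht hD (by omega) (by omega)
          (by omega)
       linarith)
    | (have := deep_three_arith_zero D t c3 c1 c2 d3 d1 d2 n h3 h1 h2 (by omega) ht hD (by omega) (by omega)
          (by omega)
       linarith)
    | (have := deep_three_arith_zero D t c3 c2 c1 d3 d2 d1 n h3 h2 h1 (by omega) ht hD (by omega) (by omega)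
          (by omega)
       linarith)

/-- The arithmetic of the deep bottom, one inside edge `x₁ x₂`: `c₁ + c₂ + c₃ = t + 1`, `c₁ + c₂ ≤ n + 2`. -/
theorem deep_three_arith_one (D t c1 c2 c3 d1 d2 d3 n : ℕ) (h1 : c1 + d1 = D) (h2 : c2 + d2 = D)
    (h3 : c3 + d3 = D) (hsum : c1 + c2 + c3 = t + 1) (ht : 2 * D < t) (hD : 3 ≤ D) (hn : c1 + c2 ≤ n + 2) :
    2 * ((D - 1) * (2 * t - 3 * D)) + 2 * (t * (D - 1)) ≤
      t * (t - 1) + 2 + c1 * d1 + c2 * d2 + c3 * d3 + (D - 3) * (t - 1) + 2 * n := by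
  have hD1 : 1 ≤ D := by omega
  have h3D : 3 * D ≤ 2 * t := by omega
  have ht1 : 1 ≤ t := by omega
  zify [hD1, h3D, ht1, hD] at *
  have hc1 : (c1 : ℤ) = D - d1 := by linarith
  have hc2 : (c2 : ℤ) = D - d2 := by linarith
  have hc3 : (c3 : ℤ) = D - d3 := by linarith
  have ht' : (t : ℤ) = 3 * D - d1 - d2 - d3 - 1 := by linarith
  rw [hc1, hc2, hc3, ht'] at *
  nlinarith [mul_nonneg (show (0:ℤ) ≤ d1 by positivity) (show (0:ℤ) ≤ d2 by positivity),
    mul_nonneg (show (0:ℤ) ≤ d1 by positivity) (show (0:ℤ) ≤ d3 by positivity),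
    mul_nonneg (show (0:ℤ) ≤ d2 by positivity) (show (0:ℤ) ≤ d3 by positivity)]

/-- The arithmetic of the deep bottom, the inside path `x₁ x₂ x₃`: `c₁ + c₂ + c₃ = t + 2`, `c₁ + c₂ ≤ n + 3`. -/
theorem deep_three_arith_two (D t c1 c2 c3 d1 d2 d3 n : ℕ) (h1 : c1 + d1 = D) (h2 : c2 + d2 = D)
    (h3 : c3 + d3 = D) (hsum : c1 + c2 + c3 = t + 2) (ht : 2 * D < t) (hD : 3 ≤ D) (hn : c1 + c2 ≤ n + 3) :
    2 * ((D - 1) * (2 * t - 3 * D)) + 2 * (t * (D - 1)) ≤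
      t * (t - 1) + 4 + c1 * d1 + c2 * d2 + c3 * d3 + (D - 3) * (t - 2) + 2 * n := by
  have hD1 : 1 ≤ D := by omega
  have h3D : 3 * D ≤ 2 * t := by omega
  have ht1 : 1 ≤ t := by omega
  have ht2 : 2 ≤ t := by omega
  zify [hD1, h3D, ht1, ht2, hD] at *
  have hc1 : (c1 : ℤ) = D - d1 := by linarith
  have hc2 : (c2 : ℤ) = D - d2 := by linarith
  have hc3 : (c3 : ℤ) = D - d3 := by linarith
  have ht' : (t : ℤ) = 3 * D - d1 - d2 - d3 - 2 := by linarith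
  rw [hc1, hc2, hc3, ht'] at *
  nlinarith [mul_nonneg (show (0:ℤ) ≤ d1 by positivity) (show (0:ℤ) ≤ d2 by positivity),
    mul_nonneg (show (0:ℤ) ≤ d1 by positivity) (show (0:ℤ) ≤ d3 by positivity),
    mul_nonneg (show (0:ℤ) ≤ d2 by positivity) (show (0:ℤ) ≤ d3 by positivity)]

/-- **THE DEFICIENCY IDENTITY AT `|L| = 3 ≤ D`:**
`2 j + 2 t (D − 1) = t (t − 1) + 2 |inside| + Σ_{x ∈ L} c(x) (D − c(x)) + (D − 3) attach + 2 |partialNbrs|`. -/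
theorem deep_three_identity (H : SimpleGraph V) [DecidableRel H.Adj] (hfree : H.CliqueFree 3) (s t j D : ℕ)
    (hs : H.edgeFinset.card = s) (w : V) (hw : deg H w + t = s) (hw1 : 1 ≤ deg H w)
    (hj : ∑ v, deg H v * deg H v + 2 * (t * (s - t - 1)) + 2 * j = s * (s + 1))
    (hD : ∀ v, offDeg H w v ≤ D) (hℓ : (nonNbrs H w).card = 3) (hD3 : 3 ≤ D) :
    2 * j + 2 * (t * (D - 1)) = t * (t - 1) + 2 * (insideEdges H w).card +
      ∑ x ∈ nonNbrs H w, offDeg H w x * (D - offDeg H w x) + (D - 3) * attach H w +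
      2 * (partialNbrs H w).card := by
  rw [deficiency_identity_split H hfree s t j D hs w hw hw1 hj hD, sum_nbr_deficiency_three H hfree w D hℓ hD3]
  ring

/-- **THE BOTTOM OF THE DEEP SUB-BAND, `|L| = 3`:** with three non-neighbours, every off-degree `≤ D`, `3 ≤ D`
and `2 D < t`: `t ≤ 3 D` and `(D − 1)(2 t − 3 D) ≤ j`. -/
theorem deep_three_lower_bound (H : SimpleGraph V) [DecidableRel H.Adj] (hfree : H.CliqueFree 3) (s t j D : ℕ)
    (hs : H.edgeFinset.card = s) (w : V) (hw : deg H w + t = s) (hw1 : 1 ≤ deg H w)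
    (hj : ∑ v, deg H v * deg H v + 2 * (t * (s - t - 1)) + 2 * j = s * (s + 1))
    (hD : ∀ v, offDeg H w v ≤ D) (hℓ : (nonNbrs H w).card = 3) (hD3 : 3 ≤ D) (ht : 2 * D < t) :
    t ≤ 3 * D ∧ (D - 1) * (2 * t - 3 * D) ≤ j := by
  obtain ⟨x₁, x₂, x₃, h12, h13, h23, hL⟩ := card_eq_three.mp hℓ
  have hx1 : x₁ ∈ nonNbrs H w := by rw [hL]; simp
  have hx2 : x₂ ∈ nonNbrs H w := by rw [hL]; simp
  have hx3 : x₃ ∈ nonNbrs H w := by rw [hL]; simp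
  have hid := deep_three_identity H hfree s t j D hs w hw hw1 hj hD hℓ hD3
  have hatt := attach_add_card_inside H hfree w
  have htE : (offEdges H w).card = t := by
    have := card_offEdges_add_deg H w
    omega
  rw [htE] at hatt
  have hI := sum_inDeg_eq_two_mul_inside H hfree w
  have hB := sum_nbrDeg_eq_attach H hfree w
  rw [hL, sum_three_eq _ x₁ x₂ x₃ h12 h13 h23] at hid hI hB
  have hc1 := offDeg_eq_nbrDeg_add_inDeg H w x₁ hx1
  have hc2 := offDeg_eq_nbrDeg_add_inDeg H w x₂ hx2
  have hc3 := offDeg_eq_nbrDeg_add_inDeg H w x₃ hx3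
  have hg1 : inDeg H w x₁ = (if H.Adj x₁ x₂ then 1 else 0) + (if H.Adj x₁ x₃ then 1 else 0) := by
    unfold inDeg
    rw [hL, card_filter_three _ x₁ x₂ x₃ h12 h13 h23]
    simp
  have hg2 : inDeg H w x₂ = (if H.Adj x₁ x₂ then 1 else 0) + (if H.Adj x₂ x₃ then 1 else 0) := by
    unfold inDeg
    rw [hL, card_filter_three _ x₁ x₂ x₃ h12 h13 h23]
    simp only [H.adj_comm x₂ x₁, SimpleGraph.irrefl, if_false, add_zero]
  have hg3 : inDeg H w x₃ = (if H.Adj x₁ x₃ then 1 else 0) + (if H.Adj x₂ x₃ then 1 else 0) := by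
    unfold inDeg
    rw [hL, card_filter_three _ x₁ x₂ x₃ h12 h13 h23]
    simp only [H.adj_comm x₃ x₁, H.adj_comm x₃ x₂, SimpleGraph.irrefl, if_false, add_zero]
  have hs12 := nbrDeg_le_nbrDeg_add_partial H hfree w x₁ x₂ hx1 hx2
  have hs13 := nbrDeg_le_nbrDeg_add_partial H hfree w x₁ x₃ hx1 hx3
  have hs21 := nbrDeg_le_nbrDeg_add_partial H hfree w x₂ x₁ hx2 hx1
  have hs23 := nbrDeg_le_nbrDeg_add_partial H hfree w x₂ x₃ hx2 hx3
  have hs31 := nbrDeg_le_nbrDeg_add_partial H hfree w x₃ x₁ hx3 hx1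
  have hs32 := nbrDeg_le_nbrDeg_add_partial H hfree w x₃ x₂ hx3 hx2
  have hD1 := hD x₁
  have hD2 := hD x₂
  have hD3' := hD x₃
  set c1 := offDeg H w x₁ with hc1def
  set c2 := offDeg H w x₂ with hc2def
  set c3 := offDeg H w x₃ with hc3def
  set b1 := nbrDeg H w x₁ with hb1def
  set b2 := nbrDeg H w x₂ with hb2def
  set b3 := nbrDeg H w x₃ with hb3def
  set g1 := inDeg H w x₁ with hg1def
  set g2 := inDeg H w x₂ with hg2def
  set g3 := inDeg H w x₃ with hg3def
  set n := (partialNbrs H w).card with hndef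
  set I := (insideEdges H w).card with hIdef
  set A := attach H w with hAdef
  obtain ⟨d1, hd1⟩ : ∃ d1, c1 + d1 = D := ⟨D - c1, by omega⟩
  obtain ⟨d2, hd2⟩ : ∃ d2, c2 + d2 = D := ⟨D - c2, by omega⟩
  obtain ⟨d3, hd3⟩ : ∃ d3, c3 + d3 = D := ⟨D - c3, by omega⟩
  have e1 : D - c1 = d1 := by omega
  have e2 : D - c2 = d2 := by omega
  have e3 : D - c3 = d3 := by omega
  rw [e1, e2, e3] at hid
  refine ⟨by omega, ?_⟩
  by_cases a12 : H.Adj x₁ x₂ <;> by_cases a13 : H.Adj x₁ x₃ <;> by_cases a23 : H.Adj x₂ x₃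
  · exact absurd a23 (fun h => no_triangle H hfree a12 h a13)
  · -- the path `x₂ x₁ x₃`
    simp only [if_pos a12, if_pos a13, if_neg a23] at hg1 hg2 hg3
    have hp := nbrDeg_add_nbrDeg_le_partial H hfree w x₂ x₁ hx2 hx1 a12.symm
    have hI2 : I = 2 := by omega
    have hA : A = t - 2 := by omega
    rw [hI2, hA] at hid
    have key := deep_three_arith_two D t c2 c1 c3 d2 d1 d3 n hd2 hd1 hd3 (by omega) ht hD3 (by omega)
    linarith only [key, hid]
  · -- the path `x₁ x₂ x₃`
    simp only [if_pos a12, if_neg a13, if_pos a23] at hg1 hg2 hg3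
    have hp := nbrDeg_add_nbrDeg_le_partial H hfree w x₁ x₂ hx1 hx2 a12
    have hI2 : I = 2 := by omega
    have hA : A = t - 2 := by omega
    rw [hI2, hA] at hid
    have key := deep_three_arith_two D t c1 c2 c3 d1 d2 d3 n hd1 hd2 hd3 (by omega) ht hD3 (by omega)
    linarith only [key, hid]
  · -- the edge `x₁ x₂`
    simp only [if_pos a12, if_neg a13, if_neg a23] at hg1 hg2 hg3
    have hp := nbrDeg_add_nbrDeg_le_partial H hfree w x₁ x₂ hx1 hx2 a12
    have hI1 : I = 1 := by omega
    have hA : A = t - 1 := by omega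
    rw [hI1, hA] at hid
    have key := deep_three_arith_one D t c1 c2 c3 d1 d2 d3 n hd1 hd2 hd3 (by omega) ht hD3 (by omega)
    linarith only [key, hid]
  · -- the path `x₁ x₃ x₂`
    simp only [if_neg a12, if_pos a13, if_pos a23] at hg1 hg2 hg3
    have hp := nbrDeg_add_nbrDeg_le_partial H hfree w x₁ x₃ hx1 hx3 a13
    have hI2 : I = 2 := by omega
    have hA : A = t - 2 := by omega
    rw [hI2, hA] at hid
    have key := deep_three_arith_two D t c1 c3 c2 d1 d3 d2 n hd1 hd3 hd2 (by omega) ht hD3 (by omega)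
    linarith only [key, hid]
  · -- the edge `x₁ x₃`
    simp only [if_neg a12, if_pos a13, if_neg a23] at hg1 hg2 hg3
    have hp := nbrDeg_add_nbrDeg_le_partial H hfree w x₁ x₃ hx1 hx3 a13
    have hI1 : I = 1 := by omega
    have hA : A = t - 1 := by omega
    rw [hI1, hA] at hid
    have key := deep_three_arith_one D t c1 c3 c2 d1 d3 d2 n hd1 hd3 hd2 (by omega) ht hD3 (by omega)
    linarith only [key, hid]
  · -- the edge `x₂ x₃`
    simp only [if_neg a12, if_neg a13, if_pos a23] at hg1 hg2 hg3
    have hp := nbrDeg_add_nbrDeg_le_partial H hfree w x₂ x₃ hx2 hx3 a23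
    have hI1 : I = 1 := by omega
    have hA : A = t - 1 := by omega
    rw [hI1, hA] at hid
    have key := deep_three_arith_one D t c2 c3 c1 d2 d3 d1 n hd2 hd3 hd1 (by omega) ht hD3 (by omega)
    linarith only [key, hid]
  · -- no inside edge
    simp only [if_neg a12, if_neg a13, if_neg a23] at hg1 hg2 hg3
    have hI0 : I = 0 := by omega
    have hA : A = t := by omega
    rw [hI0, hA] at hid
    have key := deep_three_arith_zero' D t c1 c2 c3 d1 d2 d3 n hd1 hd2 hd3 (by omega) ht hD3 (by omega)
      (by omega) (by omega) (by omega) (by omega) (by omega)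
    linarith only [key, hid]

/-- `attach = 3 #{k(y) = 3} + Σ_{y ∈ partialNbrs} k(y)` when `|L| = 3`. -/
theorem attach_eq_three_mul_add_partial (H : SimpleGraph V) [DecidableRel H.Adj] (hfree : H.CliqueFree 3) (w : V)
    (hℓ : (nonNbrs H w).card = 3) :
    attach H w = 3 * ((univ.filter (fun y => H.Adj w y)).filter (fun y => offDeg H w y = 3)).card +
      ∑ y ∈ partialNbrs H w, offDeg H w y := by
  have h : ∀ y ∈ univ.filter (fun y => H.Adj w y), offDeg H w y =
      3 * (if offDeg H w y = 3 then 1 else 0) +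
        (if 1 ≤ offDeg H w y ∧ offDeg H w y + 1 ≤ 3 then offDeg H w y else 0) := by
    intro y hy
    have hk := offDeg_le_card_nonNbrs_of_adj H hfree w y (mem_filter.mp hy).2
    rw [hℓ] at hk
    obtain ⟨k, hk'⟩ : ∃ k, offDeg H w y = k := ⟨_, rfl⟩
    rw [hk'] at hk ⊢
    interval_cases k <;> decide
  unfold attach partialNbrs
  rw [hℓ, sum_congr rfl h, sum_add_distrib, ← mul_sum, ← card_filter]
  simp only [sum_filter]

/-- **THE RIGID BOTTOM:** at `t = 3 D` (three non-neighbours, every off-degree `≤ D`, `3 ≤ D`) the band value is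
never `bottom + 1`: `j ≠ (D − 1)(2 t − 3 D) + 1`. -/
theorem deep_three_not_bottom_succ (H : SimpleGraph V) [DecidableRel H.Adj] (hfree : H.CliqueFree 3) (s t j D : ℕ)
    (hs : H.edgeFinset.card = s) (w : V) (hw : deg H w + t = s) (hw1 : 1 ≤ deg H w)
    (hj : ∑ v, deg H v * deg H v + 2 * (t * (s - t - 1)) + 2 * j = s * (s + 1))
    (hD : ∀ v, offDeg H w v ≤ D) (hℓ : (nonNbrs H w).card = 3) (hD3 : 3 ≤ D) (ht : t = 3 * D) :
    j ≠ (D - 1) * (2 * t - 3 * D) + 1 := by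
  intro hjeq
  have hid := deep_three_identity H hfree s t j D hs w hw hw1 hj hD hℓ hD3
  have hatt := attach_add_card_inside H hfree w
  have htE : (offEdges H w).card = t := by
    have := card_offEdges_add_deg H w
    omega
  rw [htE] at hatt
  have hsumc := sum_offDeg_nonNbrs_eq H w
  rw [htE] at hsumc
  -- every non-neighbour has off-degree `D`, no inside edge
  have hle : ∑ x ∈ nonNbrs H w, offDeg H w x ≤ ∑ _x ∈ nonNbrs H w, D := sum_le_sum (fun x _ => hD x)
  rw [sum_const, hℓ, smul_eq_mul] at hle
  have hI0 : (insideEdges H w).card = 0 := by omega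
  have hA : attach H w = t := by omega
  have hall : ∀ x ∈ nonNbrs H w, offDeg H w x = D := by
    intro x hx
    by_contra hne
    have hlt : offDeg H w x < D := lt_of_le_of_ne (hD x) hne
    have := sum_lt_sum (fun y _ => hD y) ⟨x, hx, hlt⟩
    rw [sum_const, hℓ, smul_eq_mul] at this
    omega
  have hsum0 : ∑ x ∈ nonNbrs H w, offDeg H w x * (D - offDeg H w x) = 0 := by
    apply sum_eq_zero
    intro x hx
    rw [hall x hx]
    simp
  rw [hsum0, hI0, hA] at hid
  set n := (partialNbrs H w).card with hndef
  have hn : n = 1 := by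
    subst ht
    have hD1 : 1 ≤ D := by omega
    have h3 : 3 * D ≤ 2 * (3 * D) := by omega
    have h1 : 1 ≤ 3 * D := by omega
    zify [hD1, h3, h1, hD3] at hid hjeq ⊢
    linarith
  obtain ⟨y₀, hy₀⟩ := card_eq_one.mp hn
  have hatt3 := attach_eq_three_mul_add_partial H hfree w hℓ
  rw [hy₀, sum_singleton] at hatt3
  have hy₀mem : y₀ ∈ partialNbrs H w := by
    rw [hy₀]
    exact mem_singleton_self y₀
  unfold partialNbrs at hy₀mem
  rw [mem_filter, mem_filter, hℓ] at hy₀mem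
  omega

end C047

end TriangleCap

end PercRepro
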